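import Literature.AlgebraicGeometry.Frobenioids.BirationalizationIsFrobenioid
import Literature.AlgebraicGeometry.Frobenioids.BirationalizationProp44General
import Literature.AlgebraicGeometry.Frobenioids.BirationalizationProp44Converse
import Literature.AlgebraicGeometry.Frobenioids.PreFrobenioidEquivalence
import HarnessLib

/-!
# Frobenioids I, Proposition 4.4 (ii)/(iv) for a GENERAL Frobenioid: co-angular morphisms, co-angular
# pre-steps, endomorphisms and monomorphisms of `C^birat` (toward "`C^birat` is a Frobenioid" without
# isotropy)

Mochizuki, *The geometry of Frobenioids I: the general theory*, Kyushu J. Math. **62** (2008)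
293–400, §4, Proposition 4.4 (ii), (iv), kurims text pp. 83–85 [cite: MochizukiFrdI2008, Prop. 4.4 (iv) p.83],
and the author's *Comments* (2024) (29)(ii): "In light of the 'dictionary' provided by assertion (iv)
[cf. also Proposition 1.4, (iv); the equivalence of categories of Proposition 1.9, (ii)], it is now a
routine exercise to check, whenever `C` is of birationally Frobenius-normalized type [cf. Definition 4.5,
(i), below], that `C^birat` is, in fact, a Frobenioid of group-like type."

PROOF-ONLY file (theorems only; seat abc-iut-L6-t20, abc-iut cell row W14 STAGE 2 = the corrected
Prop. 4.4 (ii) WITHOUT the isotropy hypothesis of `BirationalizationIsFrobenioid.lean`). Over the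
two-way dictionary of Prop. 4.4 (iv) for THE birationalization (`BirationalizationProp44General.lean`,
seat abc-iut-w4-d020; `BirationalizationProp44Converse.lean`, seat abc-iut-w5-d004) this file records, for
an ARBITRARY Frobenioid `C` and the structure `Birat.toElemZero hF hsq : C^birat ⥤ F_{0_D}`:

* `isCoAngular_homMk_iff` — a morphism `[(α, φ′)]` of `C^birat` is co-angular iff `φ′` is co-angular in
  `C` (`[(α, φ′)] = (α^birat)⁻¹ ≫ φ′^birat`, co-angularity is insensitive to isomorphisms);
* `isCoAngularPreStep_iff_isIso'` — the co-angular pre-steps of `C^birat` are exactly the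
  isomorphisms (for every `C`, not only isotropic ones);
* `isCoAngular_endo`, `isCoAngular_of_parallel_iso` — every endomorphism of `X^birat`, indeed every
  morphism parallel to an isomorphism, is co-angular (Def. 1.3 (iii)(b) of `C` applied to the denominator);
* `isFrobeniusType_toElemZero_map`, `isFrobeniusTrivial_toBirat_obj` — images of morphisms of
  Frobenius type (resp. of Frobenius-trivial objects) are of Frobenius type (resp. Frobenius-trivial);
* `mono_toBirat_map` — `C → C^birat` preserves monomorphisms (faithfulness + common denominators);
* `isIsotropic_iff_out` — `X^birat` is isotropic iff `X` is.

No statement of the paper is strengthened; nothing here concerns the disputed parts of IUT.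
-/

namespace Literature.AlgebraicGeometry.Frobenioids

open CategoryTheory Opposite

universe w v v' u u'

namespace PreFrobenioid

variable {D : Type u} [Category.{v} D] {Φ : Dᵒᵖ ⥤ CommMonCat.{w}}
  {C : Type u'} [Category.{v'} C] {F : C ⥤ ElemFrobenioid Φ}
  {hF : IsFrobenioid F} {hsq : HasBiratSquares F}

namespace Birat

/-! ### The dictionary of Prop. 4.4 (iv) in the vocabulary of `Birat.toElemZero` -/

/-- Co-angular ↦ co-angular (Prop. 4.4 (iv), image direction; abc-iut-w4-d020's
`isCoAngular_toBirat_map` read through the operations adapter). [cite: MochizukiFrdI2008, Prop. 4.4 (iv) p.83] -/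
theorem isCoAngular_toElemZero_map {A B : C} {φ : A ⟶ B} (hφ : IsCoAngular F φ) :
    IsCoAngular (toElemZero hF hsq) ((toBirat F hF hsq).map φ) :=
  (PreFrobenioidData.ofFunctor_isCoAngular (toElemZero hF hsq) _).mp (isCoAngular_toBirat_map hφ)

/-- Co-angular in `C^birat` ⇒ co-angular in `C` (Prop. 4.4 (iv), converse direction; abc-iut-w5-d004's
`isCoAngular_of_isCoAngular_toBirat_map`). [cite: MochizukiFrdI2008, Prop. 4.4 (iv) p.85] -/
theorem isCoAngular_of_toElemZero_map {A B : C} {φ : A ⟶ B}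
    (h : IsCoAngular (toElemZero hF hsq) ((toBirat F hF hsq).map φ)) : IsCoAngular F φ :=
  isCoAngular_of_isCoAngular_toBirat_map φ
    ((PreFrobenioidData.ofFunctor_isCoAngular (toElemZero hF hsq) _).mpr h)

/-- Frobenius type ↦ Frobenius type (co-angular, isometric over `0_D`, base-isomorphism), for every
Frobenioid `C`. [cite: MochizukiFrdI2008, Prop. 4.4 (iv) p.83] -/
theorem isFrobeniusType_toElemZero_map {A B : C} {φ : A ⟶ B} (hφ : IsFrobeniusType F φ) :
    IsFrobeniusType (toElemZero hF hsq) ((toBirat F hF hsq).map φ) :=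
  ⟨⟨isCoAngular_toElemZero_map hφ.1.1, isIsometry_toElemZero _⟩, isBaseIso_toElemZero_map hφ.2⟩

/-- Isotropic ↦ isotropic and conversely: `A^birat` is isotropic iff `A` is (Prop. 4.4 (iv), both
directions). [cite: MochizukiFrdI2008, Prop. 4.4 (iv) p.85] -/
theorem isIsotropic_toBirat_obj_iff (A : C) :
    IsIsotropic (toElemZero hF hsq) ((toBirat F hF hsq).obj A) ↔ IsIsotropic F A :=
  ⟨fun h => isIsotropic_of_isIsotropic_toBirat_obj
      ((PreFrobenioidData.ofFunctor_isIsotropic (toElemZero hF hsq) _).mpr h),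
    fun h => (PreFrobenioidData.ofFunctor_isIsotropic (toElemZero hF hsq) _).mp (isIsotropic_toBirat_obj h)⟩

/-- Field-shaped form: an object `X` of `C^birat` is isotropic iff the underlying object of `C` is.
[cite: MochizukiFrdI2008, Prop. 4.4 (iv) p.85] -/
theorem isIsotropic_iff_out (X : Birat F hF hsq) :
    IsIsotropic (toElemZero hF hsq) X ↔ IsIsotropic F X.out :=
  isIsotropic_toBirat_obj_iff (hF := hF) (hsq := hsq) X.out

/-! ### Co-angularity of a class of fractions -/

/-- **A morphism `[(α, φ′)]` of `C^birat` is co-angular iff `φ′` is co-angular in `C`** (for every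
Frobenioid `C`): `[(α, φ′)] = (α^birat)⁻¹ ≫ φ′^birat` and co-angularity is insensitive to composition
with isomorphisms. [cite: MochizukiFrdI2008, Prop. 4.4 (iv) p.85] -/
theorem isCoAngular_homMk_iff {A B : C} (f : BiratFrac F A B) :
    IsCoAngular (toElemZero hF hsq)
        (homMk f : (toBirat F hF hsq).obj A ⟶ (toBirat F hF hsq).obj B) ↔ IsCoAngular F f.num := by
  haveI := toBirat_inverts hF hsq f.den f.den_mem
  rw [homMk_eq_inv_comp f]
  constructor
  · intro h
    exact isCoAngular_of_toElemZero_map (IsCoAngular.of_iso_comp (inv ((toBirat F hF hsq).map f.den)) h)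
  · intro h
    exact (isCoAngular_toElemZero_map h).iso_comp (inv ((toBirat F hF hsq).map f.den))

/-- The same over arbitrary objects of `C^birat`. [cite: MochizukiFrdI2008, Prop. 4.4 (iv) p.85] -/
theorem isCoAngular_homMk_iff' {X Y : Birat F hF hsq} (f : BiratFrac F X.out Y.out) :
    IsCoAngular (toElemZero hF hsq) (homMk f : X ⟶ Y) ↔ IsCoAngular F f.num :=
  isCoAngular_homMk_iff (A := X.out) (B := Y.out) f

/-! ### Co-angular pre-steps of `C^birat` are the isomorphisms -/

/-- A co-angular pre-step of `C^birat` is an isomorphism, for EVERY Frobenioid `C`: its numerator is a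
co-angular pre-step of `C` (abc-iut-w4-d020's `isIso_homMk_of_isPreStep_of_isCoAngular`).
[cite: MochizukiFrdI2008, Prop. 4.4 (iv) p.84] -/
theorem isIso_of_isCoAngularPreStep' {X Y : Birat F hF hsq} (ψ : X ⟶ Y)
    (h : IsCoAngularPreStep (toElemZero hF hsq) ψ) : IsIso ψ := by
  obtain ⟨f, rfl⟩ := homMk_surjective ψ
  exact isIso_homMk_of_isPreStep_of_isCoAngular f
    ((PreFrobenioidData.ofFunctor_isPreStep (toElemZero hF hsq) _).mpr h.2)
    ((isCoAngular_homMk_iff' f).mp h.1)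

variable (hF hsq) in
/-- **The co-angular pre-steps of `C^birat` are exactly the isomorphisms** (every Frobenioid `C`;
isomorphisms are co-angular since `C^birat` is totally epimorphic). [cite: MochizukiFrdI2008, Prop. 4.4 (iv) p.84] -/
theorem isCoAngularPreStep_iff_isIso' {X Y : Birat F hF hsq} (ψ : X ⟶ Y) :
    IsCoAngularPreStep (toElemZero hF hsq) ψ ↔ IsIso ψ :=
  ⟨isIso_of_isCoAngularPreStep' ψ, fun _ =>
    ⟨isCoAngular_of_isIso (toElemZero hF hsq) (isTotallyEpimorphic hF hsq) ψ,
      isPreStep_of_isIso (toElemZero hF hsq) ψ⟩⟩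

/-! ### Endomorphisms are co-angular -/

/-- **Every endomorphism of an object of `C^birat` is co-angular**: `[(α, φ′)]` with `α, φ′ : A′ → A`,
and `φ′` is co-angular by Def. 1.3 (iii)(b) of `C` since `α : A′ → A` is a co-angular pre-step.
[cite: MochizukiFrdI2008, Prop. 4.4 (ii) p.83] -/
theorem isCoAngular_endo {X : Birat F hF hsq} (ψ : X ⟶ X) : IsCoAngular (toElemZero hF hsq) ψ := by
  obtain ⟨f, rfl⟩ := homMk_surjective ψ
  exact (isCoAngular_homMk_iff' f).mpr (hF.iii_b f.den f.den_mem f.num)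

/-- Every morphism of `C^birat` parallel to an isomorphism is co-angular.
[cite: MochizukiFrdI2008, Prop. 4.4 (ii) p.83] -/
theorem isCoAngular_of_parallel_iso {X Y : Birat F hF hsq} (e : X ⟶ Y) [IsIso e] (ψ : X ⟶ Y) :
    IsCoAngular (toElemZero hF hsq) ψ := by
  have h : IsCoAngular (toElemZero hF hsq) ((ψ ≫ inv e) ≫ e) := (isCoAngular_endo (ψ ≫ inv e)).comp_iso e
  rwa [Category.assoc, IsIso.inv_hom_id, Category.comp_id] at h

/-! ### Frobenius-trivial objects -/

/-- Frobenius-trivial objects of `C` are Frobenius-trivial in `C^birat`, for every Frobenioid `C` (image of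
a Frobenius-trivialising section: degrees, base-identities and Frobenius type are preserved).
[cite: MochizukiFrdI2008, Prop. 4.4 (iv) p.83] -/
theorem isFrobeniusTrivial_toBirat_obj {A : C} (h : IsFrobeniusTrivial F A) :
    IsFrobeniusTrivial (toElemZero hF hsq) ((toBirat F hF hsq).obj A) := by
  obtain ⟨ζ, hζ⟩ := h
  refine ⟨((toBirat F hF hsq).mapEnd A).comp ζ, fun n => ⟨(hζ n).1, ?_, ?_⟩⟩
  · change Base (toElemZero hF hsq) ((toBirat F hF hsq).map (ζ n)) = 𝟙 _
    rw [base_toElemZero_map]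
    exact (hζ n).2.1
  · exact isFrobeniusType_toElemZero_map (hζ n).2.2

/-! ### `C → C^birat` preserves monomorphisms -/

/-- **`C → C^birat` preserves monomorphisms**: two morphisms `W ⇢ A^birat` over a common denominator
`δ` with equal composites with `β^birat` have `(φ₁′ ≫ β)^birat = (φ₂′ ≫ β)^birat`, hence (faithfulness,
Prop. 4.4 (ii)) `φ₁′ ≫ β = φ₂′ ≫ β`, hence `φ₁′ = φ₂′`. [cite: MochizukiFrdI2008, Prop. 4.4 (ii) p.83] -/
theorem mono_toBirat_map {A B : C} (β : A ⟶ B) [Mono β] : Mono ((toBirat F hF hsq).map β) := by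
  refine ⟨fun {W} g₁ g₂ h => ?_⟩
  obtain ⟨f₁, rfl⟩ := homMk_surjective g₁
  obtain ⟨f₂, rfl⟩ := homMk_surjective g₂
  obtain ⟨E, κ₁, κ₂, hκ₁, -, hE⟩ := exists_common_refinement hF f₁.den f₂.den f₁.den_mem f₂.den_mem
  haveI := toBirat_inverts hF hsq (κ₁ ≫ f₁.den) (hκ₁.comp hF f₁.den_mem)
  have e₁ : (toBirat F hF hsq).map (κ₁ ≫ f₁.den) ≫
      (homMk f₁ : (toBirat F hF hsq).obj W.out ⟶ (toBirat F hF hsq).obj A) =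
      (toBirat F hF hsq).map (κ₁ ≫ f₁.num) := toBirat_map_comp_den_comp_homMk f₁ κ₁
  have e₂ : (toBirat F hF hsq).map (κ₁ ≫ f₁.den) ≫
      (homMk f₂ : (toBirat F hF hsq).obj W.out ⟶ (toBirat F hF hsq).obj A) =
      (toBirat F hF hsq).map (κ₂ ≫ f₂.num) := by
    rw [hE]
    exact toBirat_map_comp_den_comp_homMk f₂ κ₂
  have h' : (homMk f₁ : (toBirat F hF hsq).obj W.out ⟶ (toBirat F hF hsq).obj A) ≫
      (toBirat F hF hsq).map β =
      (homMk f₂ : (toBirat F hF hsq).obj W.out ⟶ (toBirat F hF hsq).obj A) ≫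
      (toBirat F hF hsq).map β := h
  -- (term-mode bookkeeping: the goal mixes `A` with `((toBirat).obj A).out`, which `rw` does not see through)
  have h₀ : (toBirat F hF hsq).map (κ₁ ≫ f₁.den) ≫
      ((homMk f₁ : (toBirat F hF hsq).obj W.out ⟶ (toBirat F hF hsq).obj A) ≫ (toBirat F hF hsq).map β) =
      (toBirat F hF hsq).map (κ₁ ≫ f₁.den) ≫
      ((homMk f₂ : (toBirat F hF hsq).obj W.out ⟶ (toBirat F hF hsq).obj A) ≫ (toBirat F hF hsq).map β) :=
    congrArg (fun t => (toBirat F hF hsq).map (κ₁ ≫ f₁.den) ≫ t) h'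
  have h₁ : (toBirat F hF hsq).map (κ₁ ≫ f₁.num) ≫ (toBirat F hF hsq).map β =
      (toBirat F hF hsq).map (κ₂ ≫ f₂.num) ≫ (toBirat F hF hsq).map β :=
    ((reassoc_of% e₁) ((toBirat F hF hsq).map β)).symm.trans
      (h₀.trans ((reassoc_of% e₂) ((toBirat F hF hsq).map β)))
  have h₂ : (toBirat F hF hsq).map ((κ₁ ≫ f₁.num) ≫ β) = (toBirat F hF hsq).map ((κ₂ ≫ f₂.num) ≫ β) :=
    ((toBirat F hF hsq).map_comp _ _).trans (h₁.trans ((toBirat F hF hsq).map_comp _ _).symm)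
  haveI := toBirat_faithful hF hsq
  have h₃ : (κ₁ ≫ f₁.num) ≫ β = (κ₂ ≫ f₂.num) ≫ β := (toBirat F hF hsq).map_injective h₂
  have h₄ : κ₁ ≫ f₁.num = κ₂ ≫ f₂.num := (cancel_mono β).mp h₃
  have key : (homMk f₁ : (toBirat F hF hsq).obj W.out ⟶ (toBirat F hF hsq).obj A) =
      (homMk f₂ : (toBirat F hF hsq).obj W.out ⟶ (toBirat F hF hsq).obj A) :=
    (cancel_epi ((toBirat F hF hsq).map (κ₁ ≫ f₁.den))).mp
      (e₁.trans ((congrArg (fun n => (toBirat F hF hsq).map n) h₄).trans e₂.symm))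
  exact key

end Birat

end PreFrobenioid

end Literature.AlgebraicGeometry.Frobenioids
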